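import Summits.Ventures.Crystal3D.Theorems.StickyWulffConstantCoaxialWallLawLatticeContactsTable
import HarnessLib

/-!
# FOUR LATTICE CONTACTS FORCE A LATTICE POINT, II: the real bridge (crux `CoaxialWallLaw`, stmt-Ventures-19481, line `WallLedgerF`;
# rigidity lemma of the line of `stub_multiGrainSmallHigh`)

HONEST FRAMING. Venture `Summits/Ventures/Crystal3D` (cell `crystal3d-full`), helper `--supports` the crux `CoaxialWallLaw` of
`route-Ventures-StickyWulffConstant` (REGISTERED line `WallLedgerF`, skeleton 'CoaxialWallLawCertificates' v4, stub `stub_multiGrainSmallHigh`).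
Rung credit only; F-C1 not moved; census-free.  Sequel of `…LatticeContactsTable` (the kernel table `check`/`table`): the REAL ALGEBRA that turns a
passing `check a b c` plus the real contact equations `|u|² = 2`, `2u·a = |a|²`, `2u·b = |b|²`, `2u·c = |c|²` into `u ∈ S12`:
* `dotZ_self_le_eight`, `dotZ_sub_le_eight` — contact vectors have norm² `≤ 8` and are pairwise `≤ 2√2` apart (parallelogram bounds);
* `cramer_eq`, **`exists_slot_of_fullCheck`** — full rank: `2d·u = W`, `|W|² = 8d²`, `W ∈ 2d·S12 ⇒ u ∈ S12`;
* `gramDet_eq` (Lagrange), `gramDet_pos`, **`rank2_structure`** — rank two: every real solution of the two independent equations on the sphere is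
  `2G·v = P₀ + s (p×q)` with `s²G = N` (orthogonality of the residual to `p, q` and `BAC − CAB`), `solves_real`, **`exists_slot_of_rank2Check`** —
  the kernel's consistency / sign-of-`N` / slot-count data leave `u` equal to one of the slots found.
WHAT THIS IS NOT: not the geometric statement (that is `…LatticeContacts`); not the stub; F-C1 not moved.
-/

noncomputable section

namespace Summit.Ventures.Crystal3D.Theorems

namespace LatticeContacts

open Summit.Ventures.Crystal3D Finset
open Literature.MathematicalPhysics.StatisticalMechanics (fccStacking)
open scoped InnerProductSpace

/-! ### §3 The real bridge -/

section Bridge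

/-- Real pairing of a real triple with an integer vector. -/
def dotR (u0 u1 u2 : ℝ) (p : V3) : ℝ := u0 * p.1 + u1 * p.2.1 + u2 * p.2.2

variable {u0 u1 u2 : ℝ}

/-- A contact vector has norm² `≤ 8`: `|a|² = 2u·a ≤ 2|u||a|`. -/
theorem dotZ_self_le_eight (hu : u0 ^ 2 + u1 ^ 2 + u2 ^ 2 = 2) {a : V3}
    (ha : 2 * dotR u0 u1 u2 a = (dotZ a a : ℝ)) : dotZ a a ≤ 8 := by
  have h : ((dotZ a a : ℤ) : ℝ) ≤ 8 := by
    simp only [dotR, dotZ] at ha ⊢; push_cast at ha ⊢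
    nlinarith [sq_nonneg (2 * u0 - a.1), sq_nonneg (2 * u1 - a.2.1), sq_nonneg (2 * u2 - a.2.2)]
  exact_mod_cast h

/-- Two contact vectors are at most `2√2` apart: `|a − b|² ≤ 8`. -/
theorem dotZ_sub_le_eight (hu : u0 ^ 2 + u1 ^ 2 + u2 ^ 2 = 2) {a b : V3}
    (ha : 2 * dotR u0 u1 u2 a = (dotZ a a : ℝ)) (hb : 2 * dotR u0 u1 u2 b = (dotZ b b : ℝ)) :
    dotZ (subZ a b) (subZ a b) ≤ 8 := by
  have h : ((dotZ (subZ a b) (subZ a b) : ℤ) : ℝ) ≤ 8 := by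
    simp only [dotR, dotZ, subZ] at ha hb ⊢; push_cast at ha hb ⊢
    nlinarith [sq_nonneg ((u0 - a.1) + (u0 - b.1)), sq_nonneg ((u1 - a.2.1) + (u1 - b.2.1)),
      sq_nonneg ((u2 - a.2.2) + (u2 - b.2.2))]
  exact_mod_cast h

/-- **Cramer**: `2d·u = W` componentwise, `d = a·(b×c)`, `W = cramerW a b c`. -/
theorem cramer_eq {a b c : V3} (ha : 2 * dotR u0 u1 u2 a = (dotZ a a : ℝ)) (hb : 2 * dotR u0 u1 u2 b = (dotZ b b : ℝ))
    (hc : 2 * dotR u0 u1 u2 c = (dotZ c c : ℝ)) :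
    2 * (dotZ a (crossZ b c) : ℝ) * u0 = ((cramerW a b c).1 : ℝ) ∧
    2 * (dotZ a (crossZ b c) : ℝ) * u1 = ((cramerW a b c).2.1 : ℝ) ∧
    2 * (dotZ a (crossZ b c) : ℝ) * u2 = ((cramerW a b c).2.2 : ℝ) := by
  simp only [dotR, dotZ, crossZ, cramerW, addZ, smulZ] at ha hb hc ⊢; push_cast at ha hb hc ⊢
  refine ⟨?_, ?_, ?_⟩
  · linear_combination ((b.2.1 : ℝ) * c.2.2 - b.2.2 * c.2.1) * ha + ((c.2.1 : ℝ) * a.2.2 - c.2.2 * a.2.1) * hb +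
      ((a.2.1 : ℝ) * b.2.2 - a.2.2 * b.2.1) * hc
  · linear_combination ((b.2.2 : ℝ) * c.1 - b.1 * c.2.2) * ha + ((c.2.2 : ℝ) * a.1 - c.1 * a.2.2) * hb +
      ((a.2.2 : ℝ) * b.1 - a.1 * b.2.2) * hc
  · linear_combination ((b.1 : ℝ) * c.2.1 - b.2.1 * c.1) * ha + ((c.1 : ℝ) * a.2.1 - c.2.1 * a.1) * hb +
      ((a.1 : ℝ) * b.2.1 - a.2.1 * b.1) * hc

/-- **Full rank**: the kernel's `fullCheck` and the real equations put `u` on a slot. -/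
theorem exists_slot_of_fullCheck {a b c : V3} (hd : dotZ a (crossZ b c) ≠ 0)
    (h : fullCheck a b c (dotZ a (crossZ b c)) = true) (hu : u0 ^ 2 + u1 ^ 2 + u2 ^ 2 = 2)
    (ha : 2 * dotR u0 u1 u2 a = (dotZ a a : ℝ)) (hb : 2 * dotR u0 u1 u2 b = (dotZ b b : ℝ))
    (hc : 2 * dotR u0 u1 u2 c = (dotZ c c : ℝ)) :
    ∃ σ ∈ S12, u0 = (σ.1 : ℝ) ∧ u1 = (σ.2.1 : ℝ) ∧ u2 = (σ.2.2 : ℝ) := by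
  set d := dotZ a (crossZ b c) with hd'
  set W := cramerW a b c with hW
  obtain ⟨e0, e1, e2⟩ := cramer_eq (u0 := u0) (u1 := u1) (u2 := u2) ha hb hc
  rw [← hd', ← hW] at e0 e1 e2
  -- `|W|² = 8 d²`
  have hnorm : dotZ W W = 8 * d * d := by
    have h' : ((dotZ W W : ℤ) : ℝ) = 8 * d * d := by
      simp only [dotZ]; push_cast
      rw [← e0, ← e1, ← e2]
      linear_combination (4 * (d : ℝ) ^ 2) * hu
    exact_mod_cast h'
  unfold fullCheck at h
  rw [Bool.or_eq_true] at h
  rcases h with h | h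
  · exact absurd hnorm (by simpa [bne_iff_ne] using h)
  · obtain ⟨σ, hσ, hσW⟩ := List.any_eq_true.1 h
    rw [beq_iff_eq] at hσW
    have hdR : (2 : ℝ) * d ≠ 0 := mul_ne_zero two_ne_zero (by exact_mod_cast hd)
    refine ⟨σ, hσ, ?_, ?_, ?_⟩
    · apply mul_left_cancel₀ hdR
      have := congrArg Prod.fst hσW; simp only [smulZ] at this
      rw [e0, ← this]; push_cast; ring
    · apply mul_left_cancel₀ hdR
      have := congrArg (fun x => x.2.1) hσW; simp only [smulZ] at this
      rw [e1, ← this]; push_cast; ring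
    · apply mul_left_cancel₀ hdR
      have := congrArg (fun x => x.2.2) hσW; simp only [smulZ] at this
      rw [e2, ← this]; push_cast; ring

/-- A nonzero integer vector has positive norm². -/
theorem dotZ_self_pos (n : V3) (hn : n ≠ (0, 0, 0)) : 0 < dotZ n n := by
  obtain ⟨x, y, z⟩ := n
  simp only [dotZ]
  have hne : ¬ (x = 0 ∧ y = 0 ∧ z = 0) := by
    rintro ⟨rfl, rfl, rfl⟩; exact hn rfl
  rcases ne_or_eq x 0 with hx | hx
  · nlinarith [sq_nonneg y, sq_nonneg z, sq_pos_of_ne_zero hx]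
  rcases ne_or_eq y 0 with hy | hy
  · nlinarith [sq_nonneg x, sq_nonneg z, sq_pos_of_ne_zero hy]
  rcases ne_or_eq z 0 with hz | hz
  · nlinarith [sq_nonneg x, sq_nonneg y, sq_pos_of_ne_zero hz]
  · exact absurd ⟨hx, hy, hz⟩ hne

/-- Lagrange: the Gram determinant is `|p × q|²`. -/
theorem gramDet_eq (p q : V3) : gramDet p q = dotZ (crossZ p q) (crossZ p q) := by
  simp only [gramDet, dotZ, crossZ]; ring

/-- An independent pair has positive Gram determinant. -/
theorem gramDet_pos {p q : V3} (hn : crossZ p q ≠ (0, 0, 0)) : 0 < gramDet p q := by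
  rw [gramDet_eq]; exact dotZ_self_pos _ hn

/-- **Rank two, structure of the real solutions**: if `p × q ≠ 0`, every real `v` with `|v|² = 2`, `2v·p = |p|²`, `2v·q = |q|²`
satisfies `2G v = P₀ + s (p×q)` with `s²G = N` (`G` the Gram determinant). -/
theorem rank2_structure {p q : V3} (hn : crossZ p q ≠ (0, 0, 0)) {v0 v1 v2 : ℝ} (hv : v0 ^ 2 + v1 ^ 2 + v2 ^ 2 = 2)
    (hp : 2 * dotR v0 v1 v2 p = (dotZ p p : ℝ)) (hq : 2 * dotR v0 v1 v2 q = (dotZ q q : ℝ)) :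
    ∃ s : ℝ, (2 * (gramDet p q : ℝ) * v0 = ((P0 p q).1 : ℝ) + s * ((crossZ p q).1 : ℝ) ∧
      2 * (gramDet p q : ℝ) * v1 = ((P0 p q).2.1 : ℝ) + s * ((crossZ p q).2.1 : ℝ) ∧
      2 * (gramDet p q : ℝ) * v2 = ((P0 p q).2.2 : ℝ) + s * ((crossZ p q).2.2 : ℝ)) ∧
      s ^ 2 * (gramDet p q : ℝ) = (NZ p q : ℝ) := by
  -- `G = |p×q|² > 0`
  have hlag := gramDet_eq p q
  have hGpos : 0 < gramDet p q := gramDet_pos hn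
  have hG : (gramDet p q : ℝ) ≠ 0 := by exact_mod_cast hGpos.ne'
  -- names for the real data
  set G : ℝ := (gramDet p q : ℝ) with hGdef
  set n0 : ℝ := ((crossZ p q).1 : ℝ) with hn0
  set n1 : ℝ := ((crossZ p q).2.1 : ℝ) with hn1
  set n2 : ℝ := ((crossZ p q).2.2 : ℝ) with hn2
  set P00 : ℝ := ((P0 p q).1 : ℝ) with hP00
  set P01 : ℝ := ((P0 p q).2.1 : ℝ) with hP01
  set P02 : ℝ := ((P0 p q).2.2 : ℝ) with hP02
  -- the residual `w = 2G v − P₀` is orthogonal to `p` and `q`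
  set w0 : ℝ := 2 * G * v0 - P00 with hw0
  set w1 : ℝ := 2 * G * v1 - P01 with hw1
  set w2 : ℝ := 2 * G * v2 - P02 with hw2
  have hwp : w0 * p.1 + w1 * p.2.1 + w2 * p.2.2 = 0 := by
    simp only [hw0, hw1, hw2, hGdef, hP00, hP01, hP02, gramDet, P0, addZ, smulZ, dotZ, dotR] at hp ⊢
    push_cast at hp ⊢
    linear_combination ((dotZ p p : ℝ) * 0 + ((p.1 : ℝ) * p.1 + p.2.1 * p.2.1 + p.2.2 * p.2.2) * ((q.1 : ℝ) * q.1 + q.2.1 * q.2.1 + q.2.2 * q.2.2) -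
      ((p.1 : ℝ) * q.1 + p.2.1 * q.2.1 + p.2.2 * q.2.2) ^ 2) * hp
  have hwq : w0 * q.1 + w1 * q.2.1 + w2 * q.2.2 = 0 := by
    simp only [hw0, hw1, hw2, hGdef, hP00, hP01, hP02, gramDet, P0, addZ, smulZ, dotZ, dotR] at hq ⊢
    push_cast at hq ⊢
    linear_combination (((p.1 : ℝ) * p.1 + p.2.1 * p.2.1 + p.2.2 * p.2.2) * ((q.1 : ℝ) * q.1 + q.2.1 * q.2.1 + q.2.2 * q.2.2) -
      ((p.1 : ℝ) * q.1 + p.2.1 * q.2.1 + p.2.2 * q.2.2) ^ 2) * hq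
  -- `BAC − CAB`: `|n|² w = (w·n) n`
  have hGn : G = n0 * n0 + n1 * n1 + n2 * n2 := by
    rw [hGdef, hlag, hn0, hn1, hn2]; simp only [dotZ]; push_cast; ring
  set s : ℝ := (w0 * n0 + w1 * n1 + w2 * n2) / G with hs
  have hw0' : w0 = s * n0 := by
    rw [hs, div_mul_eq_mul_div, eq_div_iff hG, hGn]
    have : n0 = (p.2.1 : ℝ) * q.2.2 - p.2.2 * q.2.1 := by rw [hn0]; simp only [crossZ]; push_cast; ring
    have e1 : n1 = (p.2.2 : ℝ) * q.1 - p.1 * q.2.2 := by rw [hn1]; simp only [crossZ]; push_cast; ring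
    have e2 : n2 = (p.1 : ℝ) * q.2.1 - p.2.1 * q.1 := by rw [hn2]; simp only [crossZ]; push_cast; ring
    rw [this, e1, e2]
    linear_combination ((((p.2.2 : ℝ) * q.1 - p.1 * q.2.2) * p.2.2 - ((p.1 : ℝ) * q.2.1 - p.2.1 * q.1) * p.2.1)) * hwq -
      ((((p.2.2 : ℝ) * q.1 - p.1 * q.2.2) * q.2.2 - ((p.1 : ℝ) * q.2.1 - p.2.1 * q.1) * q.2.1)) * hwp
  have hw1' : w1 = s * n1 := by
    rw [hs, div_mul_eq_mul_div, eq_div_iff hG, hGn]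
    have e0 : n0 = (p.2.1 : ℝ) * q.2.2 - p.2.2 * q.2.1 := by rw [hn0]; simp only [crossZ]; push_cast; ring
    have e1 : n1 = (p.2.2 : ℝ) * q.1 - p.1 * q.2.2 := by rw [hn1]; simp only [crossZ]; push_cast; ring
    have e2 : n2 = (p.1 : ℝ) * q.2.1 - p.2.1 * q.1 := by rw [hn2]; simp only [crossZ]; push_cast; ring
    rw [e0, e1, e2]
    linear_combination ((((p.1 : ℝ) * q.2.1 - p.2.1 * q.1) * p.1 - ((p.2.1 : ℝ) * q.2.2 - p.2.2 * q.2.1) * p.2.2)) * hwq -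
      ((((p.1 : ℝ) * q.2.1 - p.2.1 * q.1) * q.1 - ((p.2.1 : ℝ) * q.2.2 - p.2.2 * q.2.1) * q.2.2)) * hwp
  have hw2' : w2 = s * n2 := by
    rw [hs, div_mul_eq_mul_div, eq_div_iff hG, hGn]
    have e0 : n0 = (p.2.1 : ℝ) * q.2.2 - p.2.2 * q.2.1 := by rw [hn0]; simp only [crossZ]; push_cast; ring
    have e1 : n1 = (p.2.2 : ℝ) * q.1 - p.1 * q.2.2 := by rw [hn1]; simp only [crossZ]; push_cast; ring
    have e2 : n2 = (p.1 : ℝ) * q.2.1 - p.2.1 * q.1 := by rw [hn2]; simp only [crossZ]; push_cast; ring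
    rw [e0, e1, e2]
    linear_combination ((((p.2.1 : ℝ) * q.2.2 - p.2.2 * q.2.1) * p.2.1 - ((p.2.2 : ℝ) * q.1 - p.1 * q.2.2) * p.1)) * hwq -
      ((((p.2.1 : ℝ) * q.2.2 - p.2.2 * q.2.1) * q.2.1 - ((p.2.2 : ℝ) * q.1 - p.1 * q.2.2) * q.1)) * hwp
  refine ⟨s, ⟨by linear_combination hw0', by linear_combination hw1', by linear_combination hw2'⟩, ?_⟩
  -- the sphere: `|P₀ + s n|² = 8G²`, `P₀ ⊥ n`
  have hPn : P00 * n0 + P01 * n1 + P02 * n2 = 0 := by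
    have hZ : dotZ (P0 p q) (crossZ p q) = 0 := by simp only [P0, crossZ, addZ, smulZ, dotZ]; ring
    have hR : ((dotZ (P0 p q) (crossZ p q) : ℤ) : ℝ) = 0 := by exact_mod_cast hZ
    rw [hP00, hP01, hP02, hn0, hn1, hn2]
    simp only [dotZ] at hR; push_cast at hR; linear_combination hR
  have hsph : (2 * G * v0) ^ 2 + (2 * G * v1) ^ 2 + (2 * G * v2) ^ 2 = 8 * G ^ 2 := by
    linear_combination (4 * G ^ 2) * hv
  have hN : (NZ p q : ℝ) = 8 * G ^ 2 - (P00 ^ 2 + P01 ^ 2 + P02 ^ 2) := by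
    have hZ : NZ p q = 8 * gramDet p q * gramDet p q -
        ((P0 p q).1 * (P0 p q).1 + (P0 p q).2.1 * (P0 p q).2.1 + (P0 p q).2.2 * (P0 p q).2.2) := by
      simp only [NZ, dotZ]
    have hR := congrArg (Int.cast (R := ℝ)) hZ
    push_cast at hR
    rw [hR, hGdef, hP00, hP01, hP02]; ring
  have e0 : 2 * G * v0 = P00 + s * n0 := by linear_combination hw0'
  have e1 : 2 * G * v1 = P01 + s * n1 := by linear_combination hw1'
  have e2 : 2 * G * v2 = P02 + s * n2 := by linear_combination hw2'
  rw [e0, e1, e2] at hsph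
  rw [hN]
  linear_combination hsph - (2 * s) * hPn + s ^ 2 * hGn

/-- `S12` has no duplicates. -/
theorem S12_nodup : S12.Nodup := by decide

/-- A slot solving the three integer equations solves the real ones. -/
theorem solves_real {p q t σ : V3} (h : solves p q t σ = true) (hσ : σ ∈ S12) :
    ((σ.1 : ℝ)) ^ 2 + ((σ.2.1 : ℝ)) ^ 2 + ((σ.2.2 : ℝ)) ^ 2 = 2 ∧
    2 * dotR (σ.1 : ℝ) (σ.2.1 : ℝ) (σ.2.2 : ℝ) p = (dotZ p p : ℝ) ∧
    2 * dotR (σ.1 : ℝ) (σ.2.1 : ℝ) (σ.2.2 : ℝ) q = (dotZ q q : ℝ) ∧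
    2 * dotR (σ.1 : ℝ) (σ.2.1 : ℝ) (σ.2.2 : ℝ) t = (dotZ t t : ℝ) := by
  simp only [solves, Bool.and_eq_true, beq_iff_eq] at h
  obtain ⟨⟨h1, h2⟩, h3⟩ := h
  have h0 := S12_norm σ hσ
  simp only [dotZ] at h0 h1 h2 h3
  refine ⟨?_, ?_, ?_, ?_⟩
  · have : (((σ.1 * σ.1 + σ.2.1 * σ.2.1 + σ.2.2 * σ.2.2 : ℤ)) : ℝ) = 2 := by exact_mod_cast h0
    push_cast at this; linear_combination this
  · simp only [dotR, dotZ]; push_cast; exact_mod_cast h1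
  · simp only [dotR, dotZ]; push_cast; exact_mod_cast h2
  · simp only [dotR, dotZ]; push_cast; exact_mod_cast h3

/-- **Rank two**: the kernel's `rank2Check` (independent pair `(p, q)`, third vector `t`) and the real equations put `u` on a slot. -/
theorem exists_slot_of_rank2Check {p q t : V3} (hn : crossZ p q ≠ (0, 0, 0)) (h : rank2Check p q t = true)
    (hu : u0 ^ 2 + u1 ^ 2 + u2 ^ 2 = 2) (hp : 2 * dotR u0 u1 u2 p = (dotZ p p : ℝ))
    (hq : 2 * dotR u0 u1 u2 q = (dotZ q q : ℝ)) (ht : 2 * dotR u0 u1 u2 t = (dotZ t t : ℝ)) :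
    ∃ σ ∈ S12, u0 = (σ.1 : ℝ) ∧ u1 = (σ.2.1 : ℝ) ∧ u2 = (σ.2.2 : ℝ) := by
  have hGpos : 0 < gramDet p q := gramDet_pos hn
  have hG : (0 : ℝ) < (gramDet p q : ℝ) := by exact_mod_cast hGpos
  unfold rank2Check at h
  split_ifs at h with h1 h2 h3 h4
  · -- consistency of the third equation fails: contradiction with the real equations
    exfalso
    push Not at h1
    have e1 := congrArg Prod.fst h1
    have e2 := congrArg (fun x => x.2.1) h1
    have e3 := congrArg (fun x => x.2.2) h1
    simp only [smulZ, addZ] at e1 e2 e3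
    apply h2
    have key : ((gramDet p q * dotZ t t : ℤ) : ℝ) = ((alphaZ p q t * dotZ p p + betaZ p q t * dotZ q q : ℤ) : ℝ) := by
      have e1' : ((gramDet p q * t.1 : ℤ) : ℝ) = ((alphaZ p q t * p.1 + betaZ p q t * q.1 : ℤ) : ℝ) := by exact_mod_cast e1
      have e2' : ((gramDet p q * t.2.1 : ℤ) : ℝ) = ((alphaZ p q t * p.2.1 + betaZ p q t * q.2.1 : ℤ) : ℝ) := by exact_mod_cast e2
      have e3' : ((gramDet p q * t.2.2 : ℤ) : ℝ) = ((alphaZ p q t * p.2.2 + betaZ p q t * q.2.2 : ℤ) : ℝ) := by exact_mod_cast e3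
      push_cast at e1' e2' e3' ⊢
      rw [← ht, ← hp, ← hq]
      simp only [dotR]
      linear_combination (2 * u0) * e1' + (2 * u1) * e2' + (2 * u2) * e3'
    exact_mod_cast key
  · -- `N < 0`: no real solution
    exfalso
    obtain ⟨s, -, hs⟩ := rank2_structure hn hu hp hq
    have : (NZ p q : ℝ) < 0 := by exact_mod_cast h3
    nlinarith [sq_nonneg s]
  · -- `N = 0`: the tangent point is a slot
    have hlen : 1 ≤ (sols p q t).length := of_decide_eq_true h
    obtain ⟨σ, hσmem⟩ := List.exists_mem_of_length_pos (l := sols p q t) (by omega)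
    have hσ' := List.mem_filter.1 hσmem
    obtain ⟨hσS, hsol⟩ := hσ'
    obtain ⟨hσn, hσp, hσq, -⟩ := solves_real hsol hσS
    obtain ⟨s, ⟨e0, e1, e2⟩, hs⟩ := rank2_structure hn hu hp hq
    obtain ⟨s', ⟨f0, f1, f2⟩, hs'⟩ := rank2_structure hn hσn hσp hσq
    have hN0 : (NZ p q : ℝ) = 0 := by exact_mod_cast h4
    have hs0 : s = 0 := by
      have : s ^ 2 * (gramDet p q : ℝ) = 0 := by rw [hs, hN0]
      rcases mul_eq_zero.1 this with h' | h'
      · exact pow_eq_zero_iff (n := 2) (by norm_num) |>.1 h'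
      · exact absurd h' hG.ne'
    have hs0' : s' = 0 := by
      have : s' ^ 2 * (gramDet p q : ℝ) = 0 := by rw [hs', hN0]
      rcases mul_eq_zero.1 this with h' | h'
      · exact pow_eq_zero_iff (n := 2) (by norm_num) |>.1 h'
      · exact absurd h' hG.ne'
    subst hs0; subst hs0'
    have h2G : (2 : ℝ) * (gramDet p q : ℝ) ≠ 0 := by positivity
    refine ⟨σ, hσS, ?_, ?_, ?_⟩
    · apply mul_left_cancel₀ h2G; rw [e0, f0]
    · apply mul_left_cancel₀ h2G; rw [e1, f1]
    · apply mul_left_cancel₀ h2G; rw [e2, f2]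
  · -- `N > 0`: the two real solutions are the two slots found
    have hlen : (sols p q t).length = 2 := of_decide_eq_true h
    obtain ⟨σ₁, σ₂, hl⟩ := List.length_eq_two.1 hlen
    have hnd : (sols p q t).Nodup := S12_nodup.filter _
    rw [hl] at hnd
    have hne : σ₁ ≠ σ₂ := by
      intro heq; rw [heq] at hnd; exact (List.nodup_cons.1 hnd).1 (List.mem_singleton.2 rfl)
    have hm1 : σ₁ ∈ sols p q t := by rw [hl]; simp
    have hm2 : σ₂ ∈ sols p q t := by rw [hl]; simp
    obtain ⟨h1S, h1sol⟩ := List.mem_filter.1 hm1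
    obtain ⟨h2S, h2sol⟩ := List.mem_filter.1 hm2
    obtain ⟨h1n, h1p, h1q, -⟩ := solves_real h1sol h1S
    obtain ⟨h2n, h2p, h2q, -⟩ := solves_real h2sol h2S
    obtain ⟨s, ⟨e0, e1, e2⟩, hs⟩ := rank2_structure hn hu hp hq
    obtain ⟨s₁, ⟨f0, f1, f2⟩, hs₁⟩ := rank2_structure hn h1n h1p h1q
    obtain ⟨s₂, ⟨g0, g1, g2⟩, hs₂⟩ := rank2_structure hn h2n h2p h2q
    have h2G : (2 : ℝ) * (gramDet p q : ℝ) ≠ 0 := by positivity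
    -- `s₁ ≠ s₂`
    have hs12 : s₁ ≠ s₂ := by
      intro heq
      apply hne
      have a0 : (σ₁.1 : ℝ) = σ₂.1 := by apply mul_left_cancel₀ h2G; rw [f0, g0, heq]
      have a1 : (σ₁.2.1 : ℝ) = σ₂.2.1 := by apply mul_left_cancel₀ h2G; rw [f1, g1, heq]
      have a2 : (σ₁.2.2 : ℝ) = σ₂.2.2 := by apply mul_left_cancel₀ h2G; rw [f2, g2, heq]
      exact Prod.ext (by exact_mod_cast a0) (Prod.ext (by exact_mod_cast a1) (by exact_mod_cast a2))
    -- squares agree, so `s₂ = −s₁` and `s ∈ {s₁, s₂}`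
    have hsq1 : s ^ 2 = s₁ ^ 2 := by
      apply mul_right_cancel₀ hG.ne'; rw [hs, hs₁]
    have hsq2 : s₂ ^ 2 = s₁ ^ 2 := by
      apply mul_right_cancel₀ hG.ne'; rw [hs₂, hs₁]
    have hs2 : s₂ = -s₁ := by
      rcases sq_eq_sq_iff_eq_or_eq_neg.1 hsq2 with h' | h'
      · exact absurd h'.symm hs12
      · exact h'
    rcases sq_eq_sq_iff_eq_or_eq_neg.1 hsq1 with h' | h'
    · refine ⟨σ₁, h1S, ?_, ?_, ?_⟩
      · apply mul_left_cancel₀ h2G; rw [e0, f0, h']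
      · apply mul_left_cancel₀ h2G; rw [e1, f1, h']
      · apply mul_left_cancel₀ h2G; rw [e2, f2, h']
    · refine ⟨σ₂, h2S, ?_, ?_, ?_⟩
      · apply mul_left_cancel₀ h2G; rw [e0, g0, h', hs2]
      · apply mul_left_cancel₀ h2G; rw [e1, g1, h', hs2]
      · apply mul_left_cancel₀ h2G; rw [e2, g2, h', hs2]

end Bridge

end LatticeContacts

end Summit.Ventures.Crystal3D.Theorems

end
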